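import Summits.QuantumFields.YangMills.Theorems.BalabanUVNodesN11OmegaTopAtNewFieldShape

/-!
# DAG node N11 — THE DOOR's SHAPE MEETS K1⁹'s RESIDUAL ROWS AND PRINT's PARTITION OF UNITY AT ONCE: the REGION-INDICATOR residual `ζ_0(Y)(ω) = 𝟙{Y = R(V_1)}` ([III] (3.2):
# `R(V_1)` = the new field's large-field region, a generic region map here) obeys 12b's TWO-SCALE row `LocalLaws`, 12a's `Laws` (`ζ0 ≥ 0`) AND the named guard `ZhUnity`
# (`Σ_Y ζ_0(Y) = 1` — ONE region carries the weight), is inhabited next to EVERY `θ` with those three rows preserved, and its `Y = ∅` component is `𝟙{R(V_1) = ∅}` — the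
# (3.2) characteristic function of `V_1` once `R(V′) = ∅ ⟺ V′` is plaquette-small — so `…N11TopPairAtNewFieldShape` §4–§6 apply to it verbatim (count-neutral, LOCATED)

HEADER — WORK-UNIT METADATA.  Cell `pub-ymgap`, YM-PLAN Track A (HUMAN RULING D-0062), seat `pub-ymgap-dag-n11-d` (g33; N11 [B14], s2), route `BalabanUVNodes`, item K1⁹ =
stmt-QuantumFields-27364 (helper lane, `--kind proof --supports 27364 --as helper`, count-neutral).  [III] = [Balaban1988Convergent], [B7] = [Balaban1985Averaging], [I] =
[Balaban1987RG1].  Over this seat's `…N11TopPairAtNewFieldShape` (g33: the top pair through the door for any profile `g`; §6 the (3.2) indicator profile), `…N11OmegaTopAtNewFieldShape` (g33: the Ω-top family)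
and `…N11TwoScaleRowDoor` (g32∕g33), node00-def-T's RECORD 13 v1.7 `H` (`Stage13HParams.Zh`, the proviso rows `zhLaws : ∀ p n Ω Λ, (θ.Zh p n Ω Λ).Laws` ∕ `zhLocal : … .LocalLaws` of `Provisos₁₃CoPH`, the
named guard `Stage13HParams.ZhUnity`), 12a∕12b (`TkResidualW.Laws`, `TkResidualW.LocalLaws`).

WHY THIS FILE.  `…N11TopPairAtNewFieldShape` reads the top pair at ANY profile `g Y V′` and, in §6, at the (3.2) indicator `g Y V′ = 𝟙{PlaqSmall V′}` — the same value for every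
region `Y`.  K1⁹'s hypothesis also names print's PARTITION OF UNITY `ZhUnity` ((3.16)–(3.20): `Σ_Y ζ_j(Y) = 1`), which a `Y`-independent profile cannot meet.  Print's `ζ` is
indexed by the large-field region it determines: for a given new field `V_1` exactly ONE region `Y = R(V_1)` is «the» region, so the faithful shape at generation `0` is the
REGION INDICATOR `ζ_0(Y)(ω) = 𝟙{Y = R((ω 1).1)}` for a region map `R` (generic here; print's is cut out by the (3.2) conditions).  This file certifies, in kernel: (§1) that shape
is a new-field shape with profile `g Y V′ = 𝟙{Y = R V′}`, hence obeys the two-scale row, obeys `ζ0 ≥ 0`, and sums to `1` over `Y` (one region carries the weight); (§2) next to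
EVERY `θ` there is a parameter whose generation-`0` factor has that shape at every `(p, n, Ω, Λ)`, generations `≥ 1`, `quad`, `Phih` and all `Stage13RParams` data unchanged — and
if `θ` meets the rows `zhLocal`, `zhLaws` and the guard `ZhUnity`, SO DOES the new parameter (the three are jointly inhabited WITH the door's shape, not merely separately); (§3) its
`Y = ∅` component reads `𝟙{R V′ = ∅}`, which under the displayed dictionary `hR : R V′ = ∅ ↔ PlaqSmall(2α₀(Lη₁)²) V′` («no large-field region iff the new field is small
everywhere») is CUT OFF on the rough fields and `1` on the small ones — so the top pair's (O3′) clause at such a parameter is EXACTLY the small-field identity with [III] Thm 1's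
main-term shape on the right (`…TopPairAtNewFieldShape` §4 instantiated), and `hzh` fails (§6 there).  Nothing here pins `R` or asserts what print's regions are.

WHAT THIS FILE PROVES (0 `def`, 0 `sorry`, standard axioms).  §1 `regionIndicator_profile` (the shape IS a new-field shape, profile `𝟙{Y = R V′}`) · ★ `localLaws_of_regionIndicator` ·
`laws_nonneg_of_regionIndicator` · ★★ `finsum_regionIndicator_eq_one` (partition of unity at generation `0`).  §2 ★★ `exists_zh_regionIndicator` (inhabited next to every `θ`,
generations `≥ 1` ∕ `quad` ∕ `Phih` ∕ `Stage13RParams` unchanged) · ★★★ `zhLocal_of_regionIndicator` · ★★★ `zhLaws_of_regionIndicator` · ★★★ `zhUnity_of_regionIndicator` (the rows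
and the guard TRANSFER from `θ` to any parameter of the shape agreeing with `θ` at generations `≥ 1`) · ★★★ `exists_zh_regionIndicator_with_rows` (headline: jointly inhabited next to every `θ`) · ★★★★ `exists_zh_regionIndicatorAll_rows` (region indicator at EVERY generation:
`zhLocal`, `zhLaws`, `ZhUnity` hold OUTRIGHT, no hypothesis on `θ`).  §3 `regionIndicator_empty_cut` · `regionIndicator_empty_one` · `exists_regionMap_dictionary` (the dictionary `hR` is inhabited) · ★★★★
`top_O3_iff_main_term_on_small_of_regionIndicator` (the top pair's (O3′) clause ⟺ `slotT ≡ 0 ∨` the small-field identity with the main-term shape, at every parameter whose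
step-1 factor is the region indicator, under `hR` and the guards of `…TopPairAtNewFieldShape` §4) · ★★ `not_oneScale_of_regionIndicator` (`hzh` fails given one rough field).  §4 ★★★★
`omegaTop_O3_iff_small_of_regionIndicator` (the same for EVERY Ω-top pair `(𝕋, Λ₁)`, `…OmegaTopAtNewFieldShape` §3 instantiated).

HONEST FRAMING.  A READING ∕ inhabitation certificate on the tree's own rows (count-neutral, LOCATED): the region map `R` and the dictionary `hR` are DISPLAYED hypotheses, not
print's (3.2) regions; nothing of Bałaban asserted or refuted; the small-field identity is DISPLAYED as one side of an `↔`; K1⁹'s `∃θ` NOT advanced and NOT refuted; no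
`Stage13HParams` of record constructed (anonymous-constructor inhabitation next to an arbitrary `θ`); N11 NOT discharged; K1⁹ NOT closed; no registered stub touched; counts
unmoved (typed 28∕28 · discharged 8∕27).  One finite four-torus programme at fixed `ε = L^{−K}`; NOT ℝ⁴, NOT OS, NOT a mass gap, NOT Clay.  No `sorry`, `axiom`, `def`,
`instance`, `notation`.  Sources (SHAPE only): [III] Thm 1 p.262, (2.18) p.257, (2.21) p.258, p.267, (3.1)–(3.5) pp.264–265, (3.16)–(3.20) pp.268–269, (3.25) p.270; [B7] Prop. 2
(52)–(54) p.26; [I] Thm 1 p.259, (0.22)–(0.25) pp.256–257.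
-/

noncomputable section

open MeasureTheory
open scoped BigOperators Matrix.Norms.L2Operator

namespace Summit.QuantumFields.YangMills.Theorems.BalabanUVNodesN11RegionIndicatorResidual

open Literature.MathematicalPhysics.QuantumFieldTheory.Balaban1983to89 T4Continuum Node00 Node00.Tk B14.Eq218Concrete B14.Sect3Decomp
open Literature.MathematicalPhysics.QuantumFieldTheory.Balaban1983to89.ExpMeanLog (deltaSU)
open BalabanUVNodesN11TwoScaleRowDoor (localLaws_of_newFieldShape laws_of_newFieldShape)
open BalabanUVNodesN11TopPairAtNewFieldShape (top_O3_iff_small_of_cutoff sect2Slot_top_pair_eq_main_of_indicator not_oneScale_of_newFieldShape_of_sep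
  plaqSmall_one_of_pos smallFieldThreshold_pos)
open BalabanUVNodesN11OmegaTopAtNewFieldShape (omegaTop_O3_iff_small_of_cutoff)

variable {F : T4Family} {N : ℕ} [NeZero N]

/-! ## §1. The region-indicator shape: a new-field shape obeying the row, nonnegative, summing to one over the regions -/

section Shape

variable {K : ℕ} {V : Type} [Zero V] {R : GaugeField (F.P K) 1 (SU N) → Set (Site (F.P K) 0)} {Z : TkResidualW F N V K}

omit [NeZero N] [Zero V] in
/-- The region-indicator factor IS a new-field shape at generation `0`, with the profile `g Y V′ = 𝟙{Y = R V′}`. [cite: Balaban1988Convergent, (3.2) p.265, p.267 (shape only)] -/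
theorem regionIndicator_profile (hZ : ∀ j Y ω, Z.ζ0 j Y ω = if j = 0 then Set.indicator {R (ω 1).1} (1 : Set (Site (F.P K) 0) → ℝ) Y else 1) :
    ∀ j Y ω, Z.ζ0 j Y ω = if j = 0 then (fun Y' (V' : GaugeField (F.P K) 1 (SU N)) => Set.indicator {R V'} (1 : Set (Site (F.P K) 0) → ℝ) Y') Y (ω (0 + 1)).1 else 1 :=
  hZ

omit [NeZero N] [Zero V] in
/-- ★ **THE REGION-INDICATOR FACTOR OBEYS 12b's TWO-SCALE ROW OF RECORD** `TkResidualW.LocalLaws` (it reads `(ω 1).1` only). [cite: Balaban1988Convergent, (3.1) p.264, (3.2)–(3.4) p.265, p.267] -/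
theorem localLaws_of_regionIndicator (hZ : ∀ j Y ω, Z.ζ0 j Y ω = if j = 0 then Set.indicator {R (ω 1).1} (1 : Set (Site (F.P K) 0) → ℝ) Y else 1) :
    Z.LocalLaws :=
  localLaws_of_newFieldShape (k := 0) (g := fun Y' (V' : GaugeField (F.P K) 1 (SU N)) => Set.indicator {R V'} (1 : Set (Site (F.P K) 0) → ℝ) Y') hZ

omit [NeZero N] [Zero V] in
/-- **… AND 12a's LAW `ζ0 ≥ 0`.** [cite: Balaban1988Convergent, p.267 (bookkeeping)] -/
theorem laws_nonneg_of_regionIndicator (hZ : ∀ j Y ω, Z.ζ0 j Y ω = if j = 0 then Set.indicator {R (ω 1).1} (1 : Set (Site (F.P K) 0) → ℝ) Y else 1) : Z.Laws :=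
  laws_of_newFieldShape (k := 0) (g := fun Y' (V' : GaugeField (F.P K) 1 (SU N)) => Set.indicator {R V'} (1 : Set (Site (F.P K) 0) → ℝ) Y') hZ
    fun Y' _ => Set.indicator_nonneg (fun _ _ => zero_le_one) Y'

omit [NeZero N] [Zero V] in
/-- ★★ **PRINT's PARTITION OF UNITY AT GENERATION `0`: EXACTLY ONE REGION CARRIES THE WEIGHT** — `Σ_Y ζ_0(Y)(ω) = 𝟙{R(V_1) = R(V_1)} = 1`; at the other generations the factor is
`1` termwise, which is NOT a partition of unity — §2 keeps `θ`'s own factors there instead. [cite: Balaban1988Convergent, (3.16)–(3.20) pp.268–269] -/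
theorem finsum_regionIndicator_eq_one (hZ : ∀ j Y ω, Z.ζ0 j Y ω = if j = 0 then Set.indicator {R (ω 1).1} (1 : Set (Site (F.P K) 0) → ℝ) Y else 1)
    (ω : MultiCfg (F.P K) (SU N) V) : (∑ᶠ Y : Set (Site (F.P K) 0), Z.ζ0 0 Y ω) = 1 := by
  rw [show (∑ᶠ Y : Set (Site (F.P K) 0), Z.ζ0 0 Y ω) = ∑ᶠ Y : Set (Site (F.P K) 0), Set.indicator {R (ω 1).1} (1 : Set (Site (F.P K) 0) → ℝ) Y from
    finsum_congr fun Y => by rw [hZ, if_pos rfl]]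
  rw [finsum_eq_single _ (R (ω 1).1) fun Y hY => Set.indicator_of_notMem (by simpa using hY) _]
  rw [Set.indicator_of_mem (Set.mem_singleton _), Pi.one_apply]

end Shape

/-! ## §2. Inhabited next to every `θ`, with the rows `zhLocal`, `zhLaws` and the guard `ZhUnity` transferred -/

section Inhabited

variable (θ : Stage13HParams F N)

/-- ★★ **NEXT TO EVERY `θ` THERE IS A PARAMETER WHOSE GENERATION-0 FACTOR IS THE REGION INDICATOR** at every `(p, n, Ω, Λ)` — generations `≥ 1`, `quad`, `Phih` and all
`Stage13RParams` data unchanged (anonymous constructor; no parameter of record is built). [cite: Balaban1988Convergent, (3.2) p.265, (3.16) p.268, p.267 (shape only)] -/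
theorem exists_zh_regionIndicator (R : (p : B12.RunParams) → GaugeField (F.P p.K) 1 (SU N) → Set (Site (F.P p.K) 0)) :
    ∃ θ' : Stage13HParams F N, θ'.toStage13RParams = θ.toStage13RParams ∧ θ'.Phih = θ.Phih ∧
      (∀ p n Ω Λ j Y ω, (θ'.Zh p n Ω Λ).quad j Y ω = (θ.Zh p n Ω Λ).quad j Y ω) ∧
      (∀ p n Ω Λ j Y ω, (θ'.Zh p n Ω Λ).ζ0 (j + 1) Y ω = (θ.Zh p n Ω Λ).ζ0 (j + 1) Y ω) ∧
      ∀ p n Ω Λ Y ω, (θ'.Zh p n Ω Λ).ζ0 0 Y ω = Set.indicator {R p (ω 1).1} (1 : Set (Site (F.P p.K) 0) → ℝ) Y :=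
  ⟨{ θ with Zh := fun p n Ω Λ => ⟨fun j Y ω => if j = 0 then Set.indicator {R p (ω 1).1} (1 : Set (Site (F.P p.K) 0) → ℝ) Y else (θ.Zh p n Ω Λ).ζ0 j Y ω,
      (θ.Zh p n Ω Λ).quad⟩ }, rfl, rfl, fun _ _ _ _ _ _ _ => rfl, fun _ _ _ _ _ _ _ => rfl, fun _ _ _ _ _ _ => rfl⟩

variable {θ} {θ' : Stage13HParams F N} {R : (p : B12.RunParams) → GaugeField (F.P p.K) 1 (SU N) → Set (Site (F.P p.K) 0)}

/-- ★★★ **THE ROW `zhLocal` TRANSFERS**: if `θ`'s residual factors obey 12b's two-scale row everywhere, so do those of any parameter of the region-indicator shape at generation `0`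
agreeing with `θ` at generations `≥ 1`. [cite: Balaban1988Convergent, (3.1) p.264, (3.2)–(3.4) p.265, p.267] -/
theorem zhLocal_of_regionIndicator (hS : ∀ p n Ω Λ j Y ω, (θ'.Zh p n Ω Λ).ζ0 (j + 1) Y ω = (θ.Zh p n Ω Λ).ζ0 (j + 1) Y ω)
    (h0 : ∀ p n Ω Λ Y ω, (θ'.Zh p n Ω Λ).ζ0 0 Y ω = Set.indicator {R p (ω 1).1} (1 : Set (Site (F.P p.K) 0) → ℝ) Y)
    (hloc : ∀ p n Ω Λ, (θ.Zh p n Ω Λ).LocalLaws) : ∀ p n Ω Λ, (θ'.Zh p n Ω Λ).LocalLaws := by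
  intro p n Ω Λ
  refine ⟨fun j Y ω ω' hj hj1 => ?_⟩
  rcases j with _ | j
  · rw [h0, h0, hj1]
  · rw [hS, hS]
    exact (hloc p n Ω Λ).zeta0_local (j + 1) Y ω ω' hj hj1

/-- ★★★ **THE ROW `zhLaws` TRANSFERS** (`ζ0 ≥ 0`). [cite: Balaban1988Convergent, p.267 (bookkeeping)] -/
theorem zhLaws_of_regionIndicator (hS : ∀ p n Ω Λ j Y ω, (θ'.Zh p n Ω Λ).ζ0 (j + 1) Y ω = (θ.Zh p n Ω Λ).ζ0 (j + 1) Y ω)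
    (h0 : ∀ p n Ω Λ Y ω, (θ'.Zh p n Ω Λ).ζ0 0 Y ω = Set.indicator {R p (ω 1).1} (1 : Set (Site (F.P p.K) 0) → ℝ) Y)
    (hlaws : ∀ p n Ω Λ, (θ.Zh p n Ω Λ).Laws) : ∀ p n Ω Λ, (θ'.Zh p n Ω Λ).Laws := by
  intro p n Ω Λ
  refine ⟨fun j Y ω => ?_⟩
  rcases j with _ | j
  · rw [h0]
    exact Set.indicator_nonneg (fun _ _ => zero_le_one) Y
  · rw [hS]
    exact (hlaws p n Ω Λ).zeta0_nonneg (j + 1) Y ω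

/-- ★★★ **THE GUARD `ZhUnity` TRANSFERS** (print's partition of unity `Σ_Y ζ_j(Y) = 1` at every generation): at generation `0` exactly one region carries the weight (§1), at the
others the factors are `θ`'s. [cite: Balaban1988Convergent, (3.16)–(3.20) pp.268–269] -/
theorem zhUnity_of_regionIndicator (hS : ∀ p n Ω Λ j Y ω, (θ'.Zh p n Ω Λ).ζ0 (j + 1) Y ω = (θ.Zh p n Ω Λ).ζ0 (j + 1) Y ω)
    (h0 : ∀ p n Ω Λ Y ω, (θ'.Zh p n Ω Λ).ζ0 0 Y ω = Set.indicator {R p (ω 1).1} (1 : Set (Site (F.P p.K) 0) → ℝ) Y)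
    (hU : θ.ZhUnity) : θ'.ZhUnity := by
  intro p n Ω Λ j ω
  rcases j with _ | j
  · simp_rw [h0]
    rw [finsum_eq_single _ (R p (ω 1).1) fun Y hY => Set.indicator_of_notMem (by simpa using hY) _]
    rw [Set.indicator_of_mem (Set.mem_singleton _), Pi.one_apply]
  · simp_rw [hS]
    exact hU p n Ω Λ (j + 1) ω

/-- ★★★ **HEADLINE OF §2 — THE DOOR's SHAPE, THE TWO RESIDUAL ROWS AND THE UNITY GUARD ARE JOINTLY INHABITED NEXT TO EVERY `θ`**: for every region map `R` there is a parameter with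
the same `Stage13RParams` data and `Phih` whose generation-`0` residual factor is the region indicator `𝟙{Y = R_p(V_1)}` at every `(p, n, Ω, Λ)`, and which satisfies `zhLocal`,
`zhLaws`, `ZhUnity` whenever `θ` does.  (So K1⁹'s hypothesis-side residual constraints do not exclude the door; nothing is said about the other proviso rows, which do not read
`Zh`.) [cite: Balaban1988Convergent, (3.1) p.264, (3.2)–(3.4) p.265, p.267, (3.16)–(3.20) pp.268–269] -/
theorem exists_zh_regionIndicator_with_rows (θ : Stage13HParams F N)
    (R : (p : B12.RunParams) → GaugeField (F.P p.K) 1 (SU N) → Set (Site (F.P p.K) 0)) :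
    ∃ θ' : Stage13HParams F N, θ'.toStage13RParams = θ.toStage13RParams ∧ θ'.Phih = θ.Phih ∧
      (∀ p n Ω Λ Y ω, (θ'.Zh p n Ω Λ).ζ0 0 Y ω = Set.indicator {R p (ω 1).1} (1 : Set (Site (F.P p.K) 0) → ℝ) Y) ∧
      ((∀ p n Ω Λ, (θ.Zh p n Ω Λ).LocalLaws) → ∀ p n Ω Λ, (θ'.Zh p n Ω Λ).LocalLaws) ∧
      ((∀ p n Ω Λ, (θ.Zh p n Ω Λ).Laws) → ∀ p n Ω Λ, (θ'.Zh p n Ω Λ).Laws) ∧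
      (θ.ZhUnity → θ'.ZhUnity) := by
  obtain ⟨θ', h1, h2, -, hS, h0⟩ := exists_zh_regionIndicator θ R
  exact ⟨θ', h1, h2, h0, zhLocal_of_regionIndicator hS h0, zhLaws_of_regionIndicator hS h0, zhUnity_of_regionIndicator hS h0⟩


/-- ★★★★ **ALL GENERATIONS AT ONCE — THE ROWS AND THE GUARD HOLD OUTRIGHT**: next to every `θ` there is a parameter (same `Stage13RParams` data, `Phih`, `quad`) whose residual factor is
the region indicator AT EVERY GENERATION, `ζ_j(Y)(ω) = 𝟙{Y = R_p^j((ω (j+1)).1)}` for a family of region maps `R_p^j` of the scale-`(j+1)` field (print: the (3.2) large-field region of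
`V_{j+1}`), and THAT parameter satisfies the proviso rows `zhLocal` (two-scale: generation `j` reads `(ω (j+1)).1` only), `zhLaws` (`ζ0 ≥ 0`) and the guard `ZhUnity` (one region per
generation) UNCONDITIONALLY — no hypothesis on `θ`.  Its generation-`0` factor is §3's `hζ`. [cite: Balaban1988Convergent, (3.1) p.264, (3.2)–(3.4) p.265, p.267, (3.16)–(3.20) pp.268–269] -/
theorem exists_zh_regionIndicatorAll_rows (θ : Stage13HParams F N)
    (R : (p : B12.RunParams) → (j : ℕ) → GaugeField (F.P p.K) (j + 1) (SU N) → Set (Site (F.P p.K) 0)) :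
    ∃ θ' : Stage13HParams F N, θ'.toStage13RParams = θ.toStage13RParams ∧ θ'.Phih = θ.Phih ∧
      (∀ p n Ω Λ j Y ω, (θ'.Zh p n Ω Λ).quad j Y ω = (θ.Zh p n Ω Λ).quad j Y ω) ∧
      (∀ p n Ω Λ j Y ω, (θ'.Zh p n Ω Λ).ζ0 j Y ω = Set.indicator {R p j (ω (j + 1)).1} (1 : Set (Site (F.P p.K) 0) → ℝ) Y) ∧
      (∀ p n Ω Λ, (θ'.Zh p n Ω Λ).LocalLaws) ∧ (∀ p n Ω Λ, (θ'.Zh p n Ω Λ).Laws) ∧ θ'.ZhUnity := by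
  refine ⟨{ θ with Zh := fun p n Ω Λ => ⟨fun j Y ω => Set.indicator {R p j (ω (j + 1)).1} (1 : Set (Site (F.P p.K) 0) → ℝ) Y, (θ.Zh p n Ω Λ).quad⟩ },
    rfl, rfl, fun _ _ _ _ _ _ _ => rfl, fun _ _ _ _ _ _ _ => rfl, fun p n Ω Λ => ⟨fun j Y ω ω' _ hj1 => ?_⟩, fun p n Ω Λ => ⟨fun j Y ω => ?_⟩, fun p n Ω Λ j ω => ?_⟩
  · show Set.indicator {R p j (ω (j + 1)).1} (1 : Set (Site (F.P p.K) 0) → ℝ) Y = Set.indicator {R p j (ω' (j + 1)).1} (1 : Set (Site (F.P p.K) 0) → ℝ) Y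
    rw [hj1]
  · exact Set.indicator_nonneg (fun _ _ => zero_le_one) Y
  · show (∑ᶠ Y : Set (Site (F.P p.K) 0), Set.indicator {R p j (ω (j + 1)).1} (1 : Set (Site (F.P p.K) 0) → ℝ) Y) = 1
    rw [finsum_eq_single _ (R p j (ω (j + 1)).1) fun Y hY => Set.indicator_of_notMem (by simpa using hY) _]
    rw [Set.indicator_of_mem (Set.mem_singleton _), Pi.one_apply]


end Inhabited

/-! ## §3. The `Y = ∅` component is the (3.2) indicator under the dictionary `R V′ = ∅ ↔ V′ small`: the top pair through the door, verbatim -/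

section TopPair

variable (θ : Stage13HParams F N) (p : B12.RunParams) {R : GaugeField (F.P p.K) 1 (SU N) → Set (Site (F.P p.K) 0)}

/-- The `Y = ∅` component is CUT OFF on the rough fields once «no large-field region ⟺ small everywhere». [cite: Balaban1988Convergent, (3.2) p.265 (bookkeeping)] -/
theorem regionIndicator_empty_cut {δ : ℝ} (hR : ∀ V', R V' = ∅ ↔ PlaqSmall δ V') {V' : GaugeField (F.P p.K) 1 (SU N)} (hV' : ¬ PlaqSmall δ V') :
    Set.indicator {R V'} (1 : Set (Site (F.P p.K) 0) → ℝ) ∅ = 0 :=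
  Set.indicator_of_notMem (fun h => hV' ((hR V').1 (Set.mem_singleton_iff.1 h).symm)) _

/-- The `Y = ∅` component is `1` on the small fields under the same dictionary. [cite: Balaban1988Convergent, (3.2) p.265 (bookkeeping)] -/
theorem regionIndicator_empty_one {δ : ℝ} (hR : ∀ V', R V' = ∅ ↔ PlaqSmall δ V') {V' : GaugeField (F.P p.K) 1 (SU N)} (hV' : PlaqSmall δ V') :
    Set.indicator {R V'} (1 : Set (Site (F.P p.K) 0) → ℝ) ∅ = 1 := by
  rw [Set.indicator_of_mem (Set.mem_singleton_iff.2 ((hR V').2 hV').symm), Pi.one_apply]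

/-- **THE DICTIONARY `hR` IS INHABITED** (crudest region map: the whole torus when the new field is rough anywhere, nothing otherwise): `∃ R, ∀ V′, R V′ = ∅ ↔ PlaqSmall δ V′`.
Print's (3.2) regions are finer (unions of blocks around the rough plaquettes); only the `Y = ∅` component enters §3, for which any map with this dictionary serves.
[cite: Balaban1988Convergent, (3.2) p.265 (bookkeeping)] -/
theorem exists_regionMap_dictionary (δ : ℝ) :
    ∃ R : GaugeField (F.P p.K) 1 (SU N) → Set (Site (F.P p.K) 0), ∀ V', R V' = ∅ ↔ PlaqSmall δ V' := by
  classical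
  refine ⟨fun V' => if PlaqSmall δ V' then ∅ else Set.univ, fun V' => ⟨fun h => ?_, fun h => ?_⟩⟩
  · have h' : (if PlaqSmall δ V' then (∅ : Set (Site (F.P p.K) 0)) else Set.univ) = ∅ := h
    by_contra hV'
    rw [if_neg hV'] at h'
    exact (Set.mem_empty_iff_false (default : Site (F.P p.K) 0)).1 (h' ▸ Set.mem_univ _)
  · show (if PlaqSmall δ V' then (∅ : Set (Site (F.P p.K) 0)) else Set.univ) = ∅
    rw [if_pos h]


/-- ★★★★ **THE TOP PAIR AT A PARAMETER WHOSE STEP-1 FACTOR IS THE REGION INDICATOR** (`hζ`, displayed; dictionary `hR` at the threshold `2α₀(Lη₁)²`; Stage-13 record, `1 ≤ M`,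
`0 < M₂`, `0 < K`, the `α₀` guards, `ε₁η₁² + 8δ₀ ≤ α₀η₁²`; `s′ = (𝕋, 𝕋)`): (O3′) ⟺ `slotT_1(s′) ≡ 0` OR, for a.e. `V′` with `χ₁(s′)V′ ≠ 0` and `PlaqSmall(2α₀(Lη₁)²) V′`,
`𝐓ρ₀(𝕋,𝕋)(V′) = e^{−½quad_0(𝕋)(base₁V′)} · exp A_1(s′; u₁, (∅,0), e₁)(U_1(V′))` — `…TopPairAtNewFieldShape` §4 instantiated at the profile `𝟙{Y = R V′}`; RHS = [III] Thm 1's main-term SHAPE,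
DISPLAYED never claimed. [cite: Balaban1988Convergent, Thm 1 p.262, (3.1)–(3.5) pp.264–265, (3.25) p.270, p.267; Balaban1985Averaging, Prop. 2 (52)–(54) p.26; Balaban1987RG1, Thm 1 p.259, (0.22)–(0.25) pp.256–257] -/
theorem top_O3_iff_main_term_on_small_of_regionIndicator (hM : 1 ≤ θ.τ9.M) (hM₂ : 0 < θ.ν.M₂) (hK : 0 < p.K) {α₀ : ℝ} (hα : 0 < α₀)
    (hα3 : (143 * (((((F.P p.K).d + 4 : ℕ) : ℝ)) ^ 2 / 4) ^ 2) * α₀ ≤ 1 / 3)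
    (hα2 : 2 * α₀ ≤ 2 * deltaSU (Fin N) / ((((F.P p.K).d + 4) * (F.P p.K).L : ℕ) : ℝ) ^ 2)
    (hαε : epsOfRecord θ.ν (gOfRecord₁₃ F N θ.toStage13Params p) 1 * (F.P p.K).eta 1 ^ 2 + 4 * (2 * deltaOfRecord θ.ν (gOfRecord₁₃ F N θ.toStage13Params p) 0 θ.A₁) ≤
      α₀ * (F.P p.K).eta 1 ^ 2)
    (hR : ∀ V', R V' = ∅ ↔ PlaqSmall (2 * α₀ * (((F.P p.K).L : ℝ) ^ 1 * (F.P p.K).eta 1) ^ 2) V')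
    (s' : SeqOfRecord F θ.ν θ.τ9.M (gOfRecord₁₃ F N θ.toStage13Params p) p.K 1)
    (hζ : ∀ Y ω, (θ.Zh p 1 s'.Ω s'.Λ).ζ0 0 Y ω = Set.indicator {R (ω 1).1} (1 : Set (Site (F.P p.K) 0) → ℝ) Y)
    (hΩ : s'.Ω 1 = Set.univ) (hΛ : s'.Λ 1 = Set.univ) (u₁ : Sect2.TermValues (F.P p.K) (MatA N) (FluctV N) θ.τ9.M) (e₁ : ℝ) :
    (slotsTOfRecord F N θ.ν θ.τ9 (EOfRecord₁₃ F N θ.toStage13Params) (wOfRecord₉ F N θ.toStage9Params) θ.ppSel p (gOfRecord₁₃ F N θ.toStage13Params p) 1 s' = 0 ∨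
      ∀ᵐ V' ∂fieldMeasure (F.P p.K) 1 (SU N),
        chiSeqOfRecord F N θ.ν θ.τ9.M (gOfRecord₁₃ F N θ.toStage13Params p) p.K 1 s' V' ≠ 0 →
          slotsTOfRecord F N θ.ν θ.τ9 (EOfRecord₁₃ F N θ.toStage13Params) (wOfRecord₉ F N θ.toStage9Params) θ.ppSel p (gOfRecord₁₃ F N θ.toStage13Params p) 1 s' V' =
            sect2Slot F N (FluctV N) p.K (settingOfRecord₁₃ F N θ.toStage13Params p) (θ.rzAt p s') (WtOfRecord₁₃H F N θ p s') s' u₁ e₁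
              (UbgOfRecord₁₃CoP F N θ.toStage13Params p 1 s') V') ↔
    (slotsTOfRecord F N θ.ν θ.τ9 (EOfRecord₁₃ F N θ.toStage13Params) (wOfRecord₉ F N θ.toStage9Params) θ.ppSel p (gOfRecord₁₃ F N θ.toStage13Params p) 1 s' = 0 ∨
      ∀ᵐ V' ∂fieldMeasure (F.P p.K) 1 (SU N),
        chiSeqOfRecord F N θ.ν θ.τ9.M (gOfRecord₁₃ F N θ.toStage13Params p) p.K 1 s' V' ≠ 0 →
          PlaqSmall (2 * α₀ * (((F.P p.K).L : ℝ) ^ 1 * (F.P p.K).eta 1) ^ 2) V' →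
            slotsTOfRecord F N θ.ν θ.τ9 (EOfRecord₁₃ F N θ.toStage13Params) (wOfRecord₉ F N θ.toStage9Params) θ.ppSel p (gOfRecord₁₃ F N θ.toStage13Params p) 1 s' V' =
              Real.exp (-(1 / 2 : ℝ) * (θ.Zh p 1 s'.Ω s'.Λ).quad 0 Set.univ (baseCfg (V := FluctV N) 1 V')) *
                Real.exp ((sect2ActionDataOfRecord F N (FluctV N) p.K (settingOfRecord₁₃ F N θ.toStage13Params p) (θ.rzAt p s') s' u₁ (fun _ => ∅, fun _ => 0) e₁).action23 1
                  (UbgOfRecord₁₃CoP F N θ.toStage13Params p 1 s' (fun j => ((baseCfg (V := FluctV N) 1 V') j).1)))) := by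
  refine (top_O3_iff_small_of_cutoff θ p hM hM₂ hK hα hα3 hα2 hαε s'
    (g := fun Y (V : GaugeField (F.P p.K) 1 (SU N)) => Set.indicator {R V} (1 : Set (Site (F.P p.K) 0) → ℝ) Y)
    hζ hΩ hΛ (fun _ hV' => regionIndicator_empty_cut p hR hV') u₁ e₁).trans ?_
  refine or_congr_right (Filter.eventually_congr (Filter.Eventually.of_forall fun V' => ?_))
  refine imp_congr_right fun _ => imp_congr_right fun hs => ?_
  rw [sect2Slot_top_pair_eq_main_of_indicator θ p s'
    (g := fun Y (V : GaugeField (F.P p.K) 1 (SU N)) => Set.indicator {R V} (1 : Set (Site (F.P p.K) 0) → ℝ) Y)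
    hζ hΩ hΛ (fun _ hV' => regionIndicator_empty_one p hR hV') _ _ u₁ e₁ _ hs]

/-- ★★ **AND `hzh` FAILS AT SUCH A PARAMETER AS SOON AS ONE ROUGH COARSE FIELD EXISTS** (`V₀`, displayed; `α₀ > 0`): the `Y = ∅` component reads `1` at the unit field and `0` at
`V₀` — so the located degeneracy of `…TopPairLocalResidual` ∕ `…OmegaTopLocalResidual` (under `hzh`) does not apply. [cite: Balaban1988Convergent, (2.18) p.257, (3.2) p.265, p.267] -/
theorem not_oneScale_of_regionIndicator {n : ℕ} (s : SeqOfRecord F θ.ν θ.τ9.M (gOfRecord₁₃ F N θ.toStage13Params p) p.K n) {α₀ : ℝ} (hα : 0 < α₀)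
    (hR : ∀ V', R V' = ∅ ↔ PlaqSmall (2 * α₀ * (((F.P p.K).L : ℝ) ^ 1 * (F.P p.K).eta 1) ^ 2) V')
    (hζ : ∀ Y ω, (θ.Zh p n s.Ω s.Λ).ζ0 0 Y ω = Set.indicator {R (ω 1).1} (1 : Set (Site (F.P p.K) 0) → ℝ) Y)
    (V₀ : GaugeField (F.P p.K) 1 (SU N)) (hV₀ : ¬ PlaqSmall (2 * α₀ * (((F.P p.K).L : ℝ) ^ 1 * (F.P p.K).eta 1) ^ 2) V₀) :
    ¬ ∀ Y ω ω', ω 0 = ω' 0 → (θ.Zh p n s.Ω s.Λ).ζ0 0 Y ω = (θ.Zh p n s.Ω s.Λ).ζ0 0 Y ω' := by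
  have hsep : Set.indicator {R (1 : GaugeField (F.P p.K) 1 (SU N))} (1 : Set (Site (F.P p.K) 0) → ℝ) ∅ ≠
      Set.indicator {R V₀} (1 : Set (Site (F.P p.K) 0) → ℝ) ∅ := by
    rw [regionIndicator_empty_one p hR (plaqSmall_one_of_pos p (smallFieldThreshold_pos p hα)), regionIndicator_empty_cut p hR hV₀]
    exact one_ne_zero
  exact not_oneScale_of_newFieldShape_of_sep θ p s
    (g := fun Y (V : GaugeField (F.P p.K) 1 (SU N)) => Set.indicator {R V} (1 : Set (Site (F.P p.K) 0) → ℝ) Y) hζ (Y := ∅) hsep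

end TopPair

/-! ## §4. The Ω-top family at the region indicator: `…OmegaTopAtNewFieldShape` §3 instantiated (first step, every pair `(𝕋, Λ₁)`) -/

section OmegaTop

variable (θ : Stage13HParams F N) (p : B12.RunParams) {R : GaugeField (F.P p.K) 1 (SU N) → Set (Site (F.P p.K) 0)}

/-- ★★★★ **EVERY Ω-TOP PAIR `(𝕋, Λ₁)` AT A PARAMETER WHOSE STEP-1 FACTOR IS THE REGION INDICATOR** (dictionary `hR`; first step; `1 ≤ M`, `0 < M₂`, `0 < K`, the `α₀` guards,
`ε₁η₁² + 8δ₀ ≤ α₀η₁²`): (O3′) at `(𝕋, Λ₁)` ⟺ `slotT_1(s′) ≡ 0` OR old side `=` new side a.e. on the (3.2)-SMALL fields of the support — `…OmegaTopAtNewFieldShape.omegaTop_O3_iff_small_of_cutoff`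
at the profile `𝟙{Y = R V′}`. [cite: Balaban1988Convergent, Thm 1 p.262, (3.1)–(3.5) pp.264–265, (3.23)–(3.25) p.270, p.267; Balaban1985Averaging, Prop. 2 (53) p.26; Balaban1987RG1, Thm 1 p.259] -/
theorem omegaTop_O3_iff_small_of_regionIndicator (hM : 1 ≤ θ.τ9.M) (hM₂ : 0 < θ.ν.M₂) (hK : 0 < p.K) {α₀ : ℝ} (hα : 0 < α₀)
    (hα3 : (143 * (((((F.P p.K).d + 4 : ℕ) : ℝ)) ^ 2 / 4) ^ 2) * α₀ ≤ 1 / 3)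
    (hα2 : 2 * α₀ ≤ 2 * deltaSU (Fin N) / ((((F.P p.K).d + 4) * (F.P p.K).L : ℕ) : ℝ) ^ 2)
    (hαε : epsOfRecord θ.ν (gOfRecord₁₃ F N θ.toStage13Params p) 1 * (F.P p.K).eta 1 ^ 2 + 4 * (2 * deltaOfRecord θ.ν (gOfRecord₁₃ F N θ.toStage13Params p) 0 θ.A₁) ≤
      α₀ * (F.P p.K).eta 1 ^ 2)
    (hR : ∀ V', R V' = ∅ ↔ PlaqSmall (2 * α₀ * (((F.P p.K).L : ℝ) ^ 1 * (F.P p.K).eta 1) ^ 2) V')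
    (s' : SeqOfRecord F θ.ν θ.τ9.M (gOfRecord₁₃ F N θ.toStage13Params p) p.K 1)
    (hζ : ∀ Y ω, (θ.Zh p 1 s'.Ω s'.Λ).ζ0 0 Y ω = Set.indicator {R (ω 1).1} (1 : Set (Site (F.P p.K) 0) → ℝ) Y)
    (hΩ : s'.Ω 1 = Set.univ) (u₁ : Sect2.TermValues (F.P p.K) (MatA N) (FluctV N) θ.τ9.M) (e₁ : ℝ) :
    (slotsTOfRecord F N θ.ν θ.τ9 (EOfRecord₁₃ F N θ.toStage13Params) (wOfRecord₉ F N θ.toStage9Params) θ.ppSel p (gOfRecord₁₃ F N θ.toStage13Params p) 1 s' = 0 ∨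
      ∀ᵐ V' ∂fieldMeasure (F.P p.K) 1 (SU N),
        chiSeqOfRecord F N θ.ν θ.τ9.M (gOfRecord₁₃ F N θ.toStage13Params p) p.K 1 s' V' ≠ 0 →
          slotsTOfRecord F N θ.ν θ.τ9 (EOfRecord₁₃ F N θ.toStage13Params) (wOfRecord₉ F N θ.toStage9Params) θ.ppSel p (gOfRecord₁₃ F N θ.toStage13Params p) 1 s' V' =
            sect2Slot F N (FluctV N) p.K (settingOfRecord₁₃ F N θ.toStage13Params p) (θ.rzAt p s') (WtOfRecord₁₃H F N θ p s') s' u₁ e₁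
              (UbgOfRecord₁₃CoP F N θ.toStage13Params p 1 s') V') ↔
    (slotsTOfRecord F N θ.ν θ.τ9 (EOfRecord₁₃ F N θ.toStage13Params) (wOfRecord₉ F N θ.toStage9Params) θ.ppSel p (gOfRecord₁₃ F N θ.toStage13Params p) 1 s' = 0 ∨
      ∀ᵐ V' ∂fieldMeasure (F.P p.K) 1 (SU N),
        chiSeqOfRecord F N θ.ν θ.τ9.M (gOfRecord₁₃ F N θ.toStage13Params p) p.K 1 s' V' ≠ 0 →
          PlaqSmall (2 * α₀ * (((F.P p.K).L : ℝ) ^ 1 * (F.P p.K).eta 1) ^ 2) V' →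
            slotsTOfRecord F N θ.ν θ.τ9 (EOfRecord₁₃ F N θ.toStage13Params) (wOfRecord₉ F N θ.toStage9Params) θ.ppSel p (gOfRecord₁₃ F N θ.toStage13Params p) 1 s' V' =
              sect2Slot F N (FluctV N) p.K (settingOfRecord₁₃ F N θ.toStage13Params p) (θ.rzAt p s') (WtOfRecord₁₃H F N θ p s') s' u₁ e₁
                (UbgOfRecord₁₃CoP F N θ.toStage13Params p 1 s') V') :=
  omegaTop_O3_iff_small_of_cutoff θ p hM hM₂ hK hα hα3 hα2 hαε s'
    (g := fun Y (V : GaugeField (F.P p.K) 1 (SU N)) => Set.indicator {R V} (1 : Set (Site (F.P p.K) 0) → ℝ) Y)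
    hζ hΩ (fun _ hV' => regionIndicator_empty_cut p hR hV') u₁ e₁

end OmegaTop

end Summit.QuantumFields.YangMills.Theorems.BalabanUVNodesN11RegionIndicatorResidual

end
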